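import Summits.ABC.IUTFork.LDHNonsplitLocusHullRegime
import HarnessLib

/-!
# The fork at [IUTchIII] Corollary 3.12, L-DH level: the EXACT datum-free slot-constant locus — equal normalised local
# heights of `j(λ)` over each pole prime; there (ii′-U) is a THEOREM, off it `hreg`'s antecedent fires

Proof-only sequel (D-0012; 0 definitions, no `Prop` fact) of `LDHNonsplitLocusHullRegime.lean` (abc-iut-s2-p4, p437643;
R2 S-CHAIN TEAM TARGET #1 «hvol/hreg residue»). TAKES NO SIDE on [IUTchIII] Cor. 3.12 or on [IUTchIV] Thm. 1.10.
S. Mochizuki, *IUT IV* [Mochizuki2012], Thm. 1.10 proof Step (v) (kurims pp. 27–28; the symmetrisation in «`i† ∈ I`» is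
exact iff the places of `F_mod` over a support prime carry one `q`-order — abc-iut-S8's `slotResidue_eq_zero_of_const`);
Cor. 2.2 (ii) proof (P5) p. 46; Dupuy–Hilado [DupuyHilado2025] §3.3, §3.6, §4.7; Neukirch, *ANT* Ch. I (8.2).

`LDHNonsplitLocusHullRegime` (p437643) closed the (U)-computable half on the NON-SPLIT locus (one place of `ℚ(λ)` over each
pole prime away from `2l`). Its point-level dictionary `PointDict.logQloc_eq_pointValue` (the datum's canonical `log(q_v)`
= the point's `(−ord_V j(λ))·log N(V)/n_V` at the place `V` of `ℚ(λ)` below, `0` off `Cor22.badPlacesAvoid P {2,l}`) gives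
the EXACT datum-free description of slot-constancy:

* **`PointDict.slotConstant_of_equalHeightsPoint`** — if over every rational prime `p` the places of `F_tpd = ℚ(λ)` are
  either all outside `badPlacesAvoid P {2,l}` or all inside it with ONE value of `(−ord_V j(λ))·log N(V)/n_V`
  («equal-heights locus»; contains the non-split locus), then every genuine Θ-volume datum at `(P, l)` is slot-constant;
* **`PointDict.hullVolumeAtDatum_BIII_of_equalHeightsPoint`** (`P ∈ U_P`, `7 ≤ l`) — there `Cor22.HullVolumeAtDatum P l
  B_III(P,l)` is a THEOREM (abc-iut-S3 `hullEstimateOf_BIII_pinned` + abc-iut-S1 `R4_towerFact`): (ii′-U) CLOSED;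
  `hullRegimeAt_of_equalHeightsPoint` — the registered stub / `hreg` instance there holds with ANY conclusion;
* **`PointDict.not_slotConstant_of_unequalHeightsPoint`** — CONVERSELY, two places `V, W` of `ℚ(λ)` over one prime with `V`
  a pole away from `2l` and `W` either no such pole or of different normalised local height make EVERY datum at `(P, l)`
  non-slot-constant: there `hreg`'s antecedent fires and `hreg` DEMANDS the hull estimate (the Szpiro-type regime of
  p434756/p435674, abc-iut-S7/S8/s2-p5's pair bounds).

READING (for the C lead / §H; nothing asserted about print). The regime antecedent of v4/v5K's CONE binder `hreg`
(= `stub_hullRegime` of crux `ThetaPartII`, stmt-ABC-19678) is now an EXPLICIT DIOPHANTINE CONDITION ON `λ` ALONE: `hreg`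
is idle exactly at the admissible `(λ, l)` of the equal-heights locus (where (ii′-U) holds by volume computation) and
active exactly at the others (where, by the sandwich of abc-iut-S8/S7/s2-p1/s2-p2/s2-p5/c312-d1 and p435674, it is an
effective Szpiro-type statement). HONEST SCOPE: consequences of the typed (U)-objects at genuine data ((Ind1) = all
capsule-index permutations, R2); no datum is constructed; no side taken on Cor. 3.12 / Thm. 1.10 or on any author; typed ≠
proved. PROOF-ONLY file. [cite: Mochizuki2012, IUTchIV Thm. 1.10 Step (v) p. 27–28]
[cite: Mochizuki2012, IUTchIV Cor. 2.2 (ii) proof p. 46] [cite: DupuyHilado2025, §3.3, §3.6, §4.7]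
[cite: NeukirchANT1999, Ch. I §8 Prop. (8.2)] [claim: Mochizuki2012, status: disputed] for every IUT quotation.
-/

noncomputable section

namespace Summit.ABC.IUTFork

open Literature.IUT.HodgeTheaters Literature.IUT.LogVolume NumberField IsDedekindDomain
open Literature.NumberTheory.DiophantineGeometry.GenEll
open Summit.ABC.ABC.Theorems

namespace PointDict

variable {P : NFPoint} {l : ℕ}

/-- A place of the datum's field `F` above a place of `F_mod` over `p` has its place of `F_tpd = ℚ(λ)` over `p`
(residue characteristics descend along both towers). [cite: NeukirchANT1999, Ch. I §8] -/
private theorem finBelow_mem_placesOver_of_under_eq (T : Cor22.ThetaVolumeDatumAt P l) {p : ℕ} [Fact p.Prime] :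
    letI := T.instFieldF; letI := T.instNumberFieldF; letI := T.instAlgebraF; letI := T.instFieldK
    letI := T.instNumberFieldK; letI := T.instAlgebraK; letI := T.instFieldFbar; letI := T.instAlgebraFbar
    letI := T.instAlgebraKFbar; letI := T.instIsElliptic
    ∀ (z : HeightOneSpectrum (𝓞 T.F)) (u : placesOver (fieldOfModuli T.E) p),
      z.under (𝓞 (fieldOfModuli T.E)) = u.1 → finBelow P.F T.F z ∈ placesOver P.F p := by
  letI := T.instFieldF; letI := T.instNumberFieldF; letI := T.instAlgebraF; letI := T.instFieldK
  letI := T.instNumberFieldK; letI := T.instAlgebraK; letI := T.instFieldFbar; letI := T.instAlgebraFbar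
  letI := T.instAlgebraKFbar; letI := T.instIsElliptic
  intro z u hz
  have hfin : finBelow (fieldOfModuli T.E) T.F z = u.1 :=
    HeightOneSpectrum.ext (by rw [← hz, HeightOneSpectrum.under_asIdeal]; rfl)
  have hzp : z ∈ placesOver T.F p := by
    rw [mem_placesOver_iff_residueChar, ← residueChar_finBelow (F := fieldOfModuli T.E), hfin]
    exact (mem_placesOver_iff_residueChar u.1).mp u.2
  exact finBelow_mem_placesOver P.F T.F hzp

open scoped Classical in
/-- **The EXACT datum-free slot-constant locus.** If over every rational prime `p` the places of `F_tpd = ℚ(λ)` are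
either all outside `Cor22.badPlacesAvoid P {2,l}` or all inside it WITH ONE normalised local height
`(−ord_V j(λ))·log N(V)/n_V` («equal-heights locus»: e.g. the non-split locus), then every genuine Θ-volume datum at `(P, l)`
is slot-constant (p437643 `logQloc_eq_pointValue` place by place). The `F_tpd`-level reading of abc-iut-S8's
`slotResidue_eq_zero_of_const`. [cite: Mochizuki2012, IUTchIV Thm. 1.10 Step (v) p. 27–28] [cite: DupuyHilado2025, §3.6, §4.7] -/
theorem slotConstant_of_equalHeightsPoint (T : Cor22.ThetaVolumeDatumAt P l)
    (heq : ∀ (p : ℕ) [Fact p.Prime], ∀ V ∈ placesOver P.F p, ∀ W ∈ placesOver P.F p,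
      V ∈ Cor22.badPlacesAvoid P {2, l} →
        W ∈ Cor22.badPlacesAvoid P {2, l} ∧
          (ord P.F V (Cor22.jInv P.x) : ℝ) * logNorm P.F V / (localDegree P.F V : ℝ) =
            (ord P.F W (Cor22.jInv P.x) : ℝ) * logNorm P.F W / (localDegree P.F W : ℝ)) :
    letI := T.instFieldF; letI := T.instNumberFieldF; letI := T.instAlgebraF; letI := T.instFieldK
    letI := T.instNumberFieldK; letI := T.instAlgebraK; letI := T.instFieldFbar; letI := T.instAlgebraFbar
    letI := T.instAlgebraKFbar; letI := T.instIsElliptic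
    ∀ p ∈ T.I.supportPrimes, ∀ v w : placesOver (fieldOfModuli T.E) p,
      (Summit.ABC.IUTFork.DHData.ofInput T.I).logQloc p v = (Summit.ABC.IUTFork.DHData.ofInput T.I).logQloc p w := by
  classical
  letI := T.instFieldF; letI := T.instNumberFieldF; letI := T.instAlgebraF; letI := T.instFieldK
  letI := T.instNumberFieldK; letI := T.instAlgebraK; letI := T.instFieldFbar; letI := T.instAlgebraFbar
  letI := T.instAlgebraKFbar; letI := T.instIsElliptic
  intro p hp v w
  haveI : Fact p.Prime := ⟨T.I.prime_of_mem_supportPrimes hp⟩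
  obtain ⟨x, hx⟩ := PlaceSection.exists_under_eq (F₀ := fieldOfModuli T.E) (K := T.F) v.1
  obtain ⟨y, hy⟩ := PlaceSection.exists_under_eq (F₀ := fieldOfModuli T.E) (K := T.F) w.1
  rw [logQloc_eq_pointValue T p v x hx, logQloc_eq_pointValue T p w y hy]
  have hxp := finBelow_mem_placesOver_of_under_eq T x v hx
  have hyp := finBelow_mem_placesOver_of_under_eq T y w hy
  by_cases hX : finBelow P.F T.F x ∈ Cor22.badPlacesAvoid P {2, l}
  · obtain ⟨hY, hval⟩ := heq p _ hxp _ hyp hX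
    rw [if_pos hX, if_pos hY, hval]
  · by_cases hY : finBelow P.F T.F y ∈ Cor22.badPlacesAvoid P {2, l}
    · exact absurd (heq p _ hyp _ hxp hY).1 hX
    · rw [if_neg hX, if_neg hY]

/-- **(ii′-U) IS A THEOREM ON THE EQUAL-HEIGHTS LOCUS** (`P ∈ U_P`, `7 ≤ l`): `Cor22.HullVolumeAtDatum P l B_III(P,l)` for
EVERY datum, from abc-iut-S3's pinned junction + abc-iut-S1's (R4) + `slotConstant_of_equalHeightsPoint`. Contains
p437643 `hullVolumeAtDatum_BIII_of_nonsplitPoint`. Nothing asserted about print.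
[cite: Mochizuki2012, IUTchIV Thm. 1.10 proof Steps (ii)–(viii) p. 24–30] [claim: Mochizuki2012, status: disputed] -/
theorem hullVolumeAtDatum_BIII_of_equalHeightsPoint (hP : P ∈ UP) (h7 : 7 ≤ l)
    (heq : ∀ (p : ℕ) [Fact p.Prime], ∀ V ∈ placesOver P.F p, ∀ W ∈ placesOver P.F p,
      V ∈ Cor22.badPlacesAvoid P {2, l} →
        W ∈ Cor22.badPlacesAvoid P {2, l} ∧
          (ord P.F V (Cor22.jInv P.x) : ℝ) * logNorm P.F V / (localDegree P.F V : ℝ) =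
            (ord P.F W (Cor22.jInv P.x) : ℝ) * logNorm P.F W / (localDegree P.F W : ℝ)) :
    Cor22.HullVolumeAtDatum P l (((l : ℝ) + 1) / 4 * ((1 + 12 * (Cor22.dmod P : ℝ) / l)
      * (P.logDiff + Cor22.logCondAvoid P {2, l}) + 2 * Real.log l + 52
        + 20 / 3 * Real.log (((2 ^ 12 * 3 ^ 3 * 5 * Cor22.dmod P : ℕ) : ℝ) * (l : ℝ))
          * (Nat.primeCounting (2 ^ 12 * 3 ^ 3 * 5 * Cor22.dmod P * l) : ℝ))) :=
  fun T => hullEstimateOf_BIII_pinned T hP h7 (T.R4_towerFact hP) (slotConstant_of_equalHeightsPoint T heq)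

/-- **The `hreg`-shaped instance on the equal-heights locus holds with ANY conclusion** (its antecedent fails).
[cite: Mochizuki2012, IUTchIV Thm. 1.10 Step (v) p. 27–28] -/
theorem hullRegimeAt_of_equalHeightsPoint (T : Cor22.ThetaVolumeDatumAt P l)
    (heq : ∀ (p : ℕ) [Fact p.Prime], ∀ V ∈ placesOver P.F p, ∀ W ∈ placesOver P.F p,
      V ∈ Cor22.badPlacesAvoid P {2, l} →
        W ∈ Cor22.badPlacesAvoid P {2, l} ∧
          (ord P.F V (Cor22.jInv P.x) : ℝ) * logNorm P.F V / (localDegree P.F V : ℝ) =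
            (ord P.F W (Cor22.jInv P.x) : ℝ) * logNorm P.F W / (localDegree P.F W : ℝ))
    {C : Prop}
    (hnc : letI := T.instFieldF; letI := T.instNumberFieldF; letI := T.instAlgebraF; letI := T.instFieldK
      letI := T.instNumberFieldK; letI := T.instAlgebraK; letI := T.instFieldFbar; letI := T.instAlgebraFbar
      letI := T.instAlgebraKFbar; letI := T.instIsElliptic
      ¬ (∀ p ∈ T.I.supportPrimes, ∀ v w : placesOver (fieldOfModuli T.E) p,
        (Summit.ABC.IUTFork.DHData.ofInput T.I).logQloc p v = (Summit.ABC.IUTFork.DHData.ofInput T.I).logQloc p w)) :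
    C :=
  absurd (slotConstant_of_equalHeightsPoint T heq) hnc

open scoped Classical in
/-- **Conversely, off the equal-heights locus EVERY datum is non-slot-constant** (so there `hreg`'s antecedent fires and
`hreg` demands the hull estimate): if two places `V, W` of `ℚ(λ)` over one rational prime have `V` a pole away from `2l`
and either `W` no such pole or a different normalised local height, then the canonical `log(q)` of any datum differs at
the places of `F_mod` below places of `F` above `V` and `W` (p437643 `logQloc_eq_pointValue`, `under_mem_badPrimesMod_iff`;
a pole has nonzero normalised local height). With `slotConstant_of_equalHeightsPoint`: the datum-free locus is EXACT.
[cite: Mochizuki2012, IUTchIV Thm. 1.10 Step (v) p. 27–28] [cite: DupuyHilado2025, §3.3, §3.6, §4.7] -/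
theorem not_slotConstant_of_unequalHeightsPoint (T : Cor22.ThetaVolumeDatumAt P l) {p : ℕ} [Fact p.Prime]
    {V W : HeightOneSpectrum (𝓞 P.F)} (hV : V ∈ placesOver P.F p) (hW : W ∈ placesOver P.F p)
    (hVb : V ∈ Cor22.badPlacesAvoid P {2, l})
    (hne : W ∈ Cor22.badPlacesAvoid P {2, l} →
      (ord P.F V (Cor22.jInv P.x) : ℝ) * logNorm P.F V / (localDegree P.F V : ℝ) ≠
        (ord P.F W (Cor22.jInv P.x) : ℝ) * logNorm P.F W / (localDegree P.F W : ℝ)) :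
    letI := T.instFieldF; letI := T.instNumberFieldF; letI := T.instAlgebraF; letI := T.instFieldK
    letI := T.instNumberFieldK; letI := T.instAlgebraK; letI := T.instFieldFbar; letI := T.instAlgebraFbar
    letI := T.instAlgebraKFbar; letI := T.instIsElliptic
    ¬ (∀ p ∈ T.I.supportPrimes, ∀ v w : placesOver (fieldOfModuli T.E) p,
      (Summit.ABC.IUTFork.DHData.ofInput T.I).logQloc p v = (Summit.ABC.IUTFork.DHData.ofInput T.I).logQloc p w) := by
  classical
  letI := T.instFieldF; letI := T.instNumberFieldF; letI := T.instAlgebraF; letI := T.instFieldK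
  letI := T.instNumberFieldK; letI := T.instAlgebraK; letI := T.instFieldFbar; letI := T.instAlgebraFbar
  letI := T.instAlgebraKFbar; letI := T.instIsElliptic
  intro hconst
  -- places `x | V`, `y | W` of `F`, and the places of `F_mod` below them
  obtain ⟨x, hx⟩ := PlaceSection.exists_under_eq (F₀ := P.F) (K := T.F) V
  obtain ⟨y, hy⟩ := PlaceSection.exists_under_eq (F₀ := P.F) (K := T.F) W
  have hfx : finBelow P.F T.F x = V := HeightOneSpectrum.ext (by rw [← hx, HeightOneSpectrum.under_asIdeal]; rfl)
  have hfy : finBelow P.F T.F y = W := HeightOneSpectrum.ext (by rw [← hy, HeightOneSpectrum.under_asIdeal]; rfl)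
  have hres : ∀ (z : HeightOneSpectrum (𝓞 T.F)) (U : HeightOneSpectrum (𝓞 P.F)), U ∈ placesOver P.F p →
      finBelow P.F T.F z = U → z.under (𝓞 (fieldOfModuli T.E)) ∈ placesOver (fieldOfModuli T.E) p := by
    intro z U hU hz
    have hzp : z ∈ placesOver T.F p := by
      rw [mem_placesOver_iff_residueChar, ← residueChar_finBelow (F := P.F), hz]
      exact (mem_placesOver_iff_residueChar U).mp hU
    have h1 := finBelow_mem_placesOver (fieldOfModuli T.E) T.F hzp
    have hfin : finBelow (fieldOfModuli T.E) T.F z = z.under (𝓞 (fieldOfModuli T.E)) :=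
      HeightOneSpectrum.ext (by rw [HeightOneSpectrum.under_asIdeal]; rfl)
    rwa [hfin] at h1
  have hvp := hres x V hV hfx
  have hwp := hres y W hW hfy
  -- the bad place below `x` puts `p` among the support primes
  have hvbad : x.under (𝓞 (fieldOfModuli T.E)) ∈ ThetaData.badPrimesMod T.D := by
    rw [under_mem_badPrimesMod_iff T x, hfx]; exact hVb
  have hpT : p ∈ T.I.supportPrimes := by
    have hS : T.I.X.S = ThetaData.badPrimesMod T.D := (X_S_eq T).1
    have h1 := T.I.residueChar_mem_supportPrimes (v := x.under (𝓞 (fieldOfModuli T.E))) (by rw [hS]; exact hvbad)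
    rwa [← (mem_placesOver_iff_residueChar _).mp hvp]
  have h := hconst p hpT ⟨_, hvp⟩ ⟨_, hwp⟩
  rw [logQloc_eq_pointValue T p ⟨_, hvp⟩ x rfl, logQloc_eq_pointValue T p ⟨_, hwp⟩ y rfl, hfx, hfy, if_pos hVb] at h
  by_cases hWb : W ∈ Cor22.badPlacesAvoid P {2, l}
  · rw [if_pos hWb, neg_inj] at h
    exact hne hWb h
  · rw [if_neg hWb, neg_eq_zero] at h
    -- `V` is a pole: its normalised local height is nonzero
    have hord : ord P.F V (Cor22.jInv P.x) < 0 :=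
      (Cor22.mem_badPlaces_iff_ord_neg P V).mp (Finset.mem_filter.mp hVb).1
    have h1 : (ord P.F V (Cor22.jInv P.x) : ℝ) < 0 := by exact_mod_cast hord
    have h2 : 0 < logNorm P.F V := logNorm_pos P.F V
    have h3 : (0 : ℝ) < (localDegree P.F V : ℝ) := by exact_mod_cast localDegree_pos P.F V
    have : (ord P.F V (Cor22.jInv P.x) : ℝ) * logNorm P.F V / (localDegree P.F V : ℝ) < 0 :=
      div_neg_of_neg_of_pos (mul_neg_of_neg_of_pos h1 h2) h3
    linarith

end PointDict

end Summit.ABC.IUTFork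

end
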